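import Literature.Analysis.Complex.PuiseuxAtInfinity
import Mathlib.RingTheory.Polynomial.UniqueFactorization
import Mathlib.Algebra.MvPolynomial.Funext
import HarnessLib

/-!
# A finite atlas of Puiseux branches at infinity for an arbitrary plane curve

Topic `Literature/Analysis/Complex` (namespace `Literature.Analysis.Complex.PuiseuxInfinity`).
For an arbitrary non-zero `P ∈ ℂ[X, Y]` (possibly reducible, non-reduced) all solutions of
`P(u, v) = 0` with `|u|` large lie on finitely many convergent Laurent–Puiseux branches with a
COMMON ramification index: there are `e ≥ 1`, `R`, `0 < r ≤ 1` and a finite set `B` of pairs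
`(y, M)`, `y` holomorphic on `|t| < r`, such that whenever `P(u, v) = 0`, `|u| > R` and
`tᵉ = u⁻¹` (ANY `e`-th root), then `0 < |t| < r` and `v = y(t)/t^M` for some `(y, M) ∈ B`
(`exists_branch_atlas`). Proof: factor `P` into irreducibles in the UFD `ℂ[X][Y]`, apply the
irreducible case (`exists_branches_at_infinity`) to each factor of positive `Y`-degree, discard
the factors in `ℂ[X]` (non-vanishing for `|u|` large), and absorb the `e_f`-th roots of unity
relating the various roots `u^{-1/e_f}` to the master root `t = u^{-1/e}`, `e = ∏ e_f`, into
the atlas. PROVED, no definition. [folklore]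

## References

* E. Brieskorn, H. Knörrer, *Plane Algebraic Curves*, Birkhäuser 1986, §8.3. [folklore]
-/

noncomputable section

open Complex Filter Topology Set Metric Polynomial

namespace Literature.Analysis.Complex

namespace PuiseuxInfinity

/-! ### From `ℂ[X, Y]` (as `MvPolynomial (Fin 2) ℂ`) to `ℂ[X][Y]` -/

/-- Every `P ∈ ℂ[X₀, X₁]` is represented by a `Q ∈ ℂ[X][Y]` with the same values,
`Q(u)(v) = P(u, v)`, and `Q ≠ 0` if `P ≠ 0`. [folklore] -/
theorem exists_polynomial_polynomial (P : MvPolynomial (Fin 2) ℂ) :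
    ∃ Q : Polynomial ℂ[X], (∀ u v : ℂ, (Q.map (evalRingHom u)).eval v = MvPolynomial.eval ![u, v] P) ∧
      (P ≠ 0 → Q ≠ 0) := by
  classical
  set Q : Polynomial ℂ[X] := ∑ d ∈ P.support,
    Polynomial.C (Polynomial.C (P.coeff d) * Polynomial.X ^ (d 0)) * Polynomial.X ^ (d 1) with hQ
  have hval : ∀ u v : ℂ, (Q.map (evalRingHom u)).eval v = MvPolynomial.eval ![u, v] P := by
    intro u v
    rw [hQ, Polynomial.map_sum, eval_finsetSum, MvPolynomial.eval_eq']
    refine Finset.sum_congr rfl fun d _ => ?_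
    rw [Polynomial.map_mul, Polynomial.map_pow, Polynomial.map_X, Polynomial.map_C, eval_mul,
      eval_pow, eval_X, eval_C, coe_evalRingHom, eval_mul, eval_C, eval_pow, eval_X,
      Fin.prod_univ_two]
    simp only [Matrix.cons_val_zero, Matrix.cons_val_one]
    ring
  refine ⟨Q, hval, fun hP hQ0 => hP ?_⟩
  apply MvPolynomial.funext
  intro x
  have hx : x = ![x 0, x 1] := by funext i; fin_cases i <;> rfl
  rw [map_zero, hx, ← hval, hQ0, Polynomial.map_zero, eval_zero]

/-- A non-zero `g ∈ ℂ[X]` does not vanish for `|u|` large. [folklore] -/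
theorem exists_forall_eval_ne_zero {g : ℂ[X]} (hg : g ≠ 0) :
    ∃ R : ℝ, ∀ u : ℂ, R < ‖u‖ → g.eval u ≠ 0 := by
  classical
  refine ⟨(g.roots.map fun z => ‖z‖).sum, fun u hu h0 => ?_⟩
  have hmem : u ∈ g.roots := (mem_roots hg).2 h0
  have : ‖u‖ ≤ (g.roots.map fun z => ‖z‖).sum :=
    Multiset.single_le_sum (fun x hx => by
      obtain ⟨z, -, rfl⟩ := Multiset.mem_map.1 hx; exact norm_nonneg z)
      _ (Multiset.mem_map_of_mem _ hmem)
  linarith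

/-- The evaluation `Q ↦ Q(u)(v)` as a ring homomorphism `ℂ[X][Y] → ℂ`. [folklore] -/
theorem eval₂RingHom_evalRingHom_apply (Q : Polynomial ℂ[X]) (u v : ℂ) :
    eval₂RingHom (evalRingHom u) v Q = (Q.map (evalRingHom u)).eval v := by
  rw [coe_eval₂RingHom, eval_map]

/-- **A zero of `Q` is a zero of one of its irreducible factors.** [folklore] -/
theorem exists_factor_eval_eq_zero {Q : Polynomial ℂ[X]} (hQ : Q ≠ 0) {u v : ℂ}
    (h : (Q.map (evalRingHom u)).eval v = 0) :
    ∃ f ∈ UniqueFactorizationMonoid.factors Q, (f.map (evalRingHom u)).eval v = 0 := by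
  classical
  set ψ : Polynomial ℂ[X] →+* ℂ := eval₂RingHom (evalRingHom u) v with hψ
  obtain ⟨w, hw⟩ := UniqueFactorizationMonoid.factors_prod hQ
  have hψQ : ψ Q = 0 := by rw [hψ, eval₂RingHom_evalRingHom_apply]; exact h
  rw [← hw, map_mul] at hψQ
  have hunit : ψ (w : Polynomial ℂ[X]) ≠ 0 := (w.isUnit.map ψ).ne_zero
  have hprod : ψ (UniqueFactorizationMonoid.factors Q).prod = 0 :=
    (mul_eq_zero.1 hψQ).resolve_right hunit
  rw [map_multiset_prod, Multiset.prod_eq_zero_iff, Multiset.mem_map] at hprod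
  obtain ⟨f, hf, hf0⟩ := hprod
  exact ⟨f, hf, by rw [← eval₂RingHom_evalRingHom_apply]; exact hf0⟩

/-- **Finite atlas of Puiseux branches at infinity with a common ramification index.** For a
non-zero `P ∈ ℂ[X, Y]` there are `e ≥ 1`, `R`, `0 < r ≤ 1` and a finite set `B` of pairs `(y, M)`
with `y` holomorphic on `|t| < r`, such that every solution of `P(u, v) = 0` with `|u| > R`
satisfies: for every `t` with `tᵉ = u⁻¹` one has `0 < |t| < r` and `v = y(t)/t^M` for some
`(y, M) ∈ B`. [folklore] -/
theorem exists_branch_atlas (P : MvPolynomial (Fin 2) ℂ) (hP : P ≠ 0) :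
    ∃ (e : ℕ) (_ : 0 < e) (R r : ℝ) (_ : 0 < r) (_ : r ≤ 1) (B : Finset ((ℂ → ℂ) × ℕ)),
      (∀ b ∈ B, DifferentiableOn ℂ b.1 (ball 0 r)) ∧
      ∀ u v : ℂ, R < ‖u‖ → MvPolynomial.eval ![u, v] P = 0 → ∀ t : ℂ, t ^ e = u⁻¹ →
        t ≠ 0 ∧ ‖t‖ < r ∧ ∃ b ∈ B, v = b.1 t / t ^ b.2 := by
  classical
  obtain ⟨Q, hQval, hQne⟩ := exists_polynomial_polynomial P
  have hQ0 : Q ≠ 0 := hQne hP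
  set F : Finset (Polynomial ℂ[X]) := (UniqueFactorizationMonoid.factors Q).toFinset with hF
  have hirr : ∀ f ∈ F, Irreducible f := fun f hf =>
    UniqueFactorizationMonoid.irreducible_of_factor f (Multiset.mem_toFinset.1 hf)
  -- Puiseux data for the factors of positive degree
  have hdata : ∀ f : Polynomial ℂ[X], Irreducible f ∧ 0 < f.natDegree →
      ∃ (e : ℕ) (_ : 0 < e) (M : ℕ) (r : ℝ) (_ : 0 < r) (y : Fin f.natDegree → ℂ → ℂ),
        (∀ i, DifferentiableOn ℂ (y i) (ball 0 r)) ∧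
        ∀ u v : ℂ, r⁻¹ ^ e < ‖u‖ → (f.map (evalRingHom u)).eval v = 0 →
          ∃ i, ∃ t : ℂ, t ≠ 0 ∧ ‖t‖ < r ∧ t ^ e = u⁻¹ ∧ v = y i t / t ^ M := by
    rintro f ⟨hf1, hf2⟩
    obtain ⟨e, he, M, r, hr, y, hy, -, hroots⟩ := exists_branches_at_infinity f hf1 hf2
    exact ⟨e, he, M, r, hr, y, hy, hroots⟩
  choose! ef hef Mf rf hrf yf hyf hrootf using hdata
  -- bounds for the factors of degree zero
  have hconst : ∀ f : Polynomial ℂ[X], f ≠ 0 ∧ f.natDegree = 0 →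
      ∃ Rg : ℝ, ∀ u : ℂ, Rg < ‖u‖ → ∀ v, (f.map (evalRingHom u)).eval v ≠ 0 := by
    rintro f ⟨hf0, hfd⟩
    rw [natDegree_eq_zero] at hfd
    obtain ⟨g, rfl⟩ := hfd
    have hg : g ≠ 0 := by rintro rfl; exact hf0 (by simp)
    obtain ⟨Rg, hRg⟩ := exists_forall_eval_ne_zero hg
    refine ⟨Rg, fun u hu v => ?_⟩
    rw [Polynomial.map_C, eval_C, coe_evalRingHom]
    exact hRg u hu
  choose! Rg hRg using hconst
  -- the positive-degree factors, the common ramification index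
  set Fp : Finset (Polynomial ℂ[X]) := F.filter fun f => 0 < f.natDegree with hFpdef
  have hFp : ∀ f ∈ Fp, Irreducible f ∧ 0 < f.natDegree := fun f hf => by
    rw [hFpdef, Finset.mem_filter] at hf; exact ⟨hirr f hf.1, hf.2⟩
  set e : ℕ := ∏ f ∈ Fp, ef f with he
  have hepos : 0 < e := Finset.prod_pos fun f hf => hef f (hFp f hf)
  have hdvd : ∀ f ∈ Fp, ef f ∣ e := fun f hf => Finset.dvd_prod_of_mem _ hf
  -- radii
  set r : ℝ := min 1 (if hne : Fp.Nonempty then Fp.inf' hne rf else 1) with hr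
  have hr0 : 0 < r := by
    rw [hr]; refine lt_min one_pos ?_
    split_ifs with hne
    · exact (Finset.lt_inf'_iff hne).2 fun f hf => hrf f (hFp f hf)
    · exact one_pos
  have hr1 : r ≤ 1 := min_le_left _ _
  have hrf' : ∀ f ∈ Fp, r ≤ rf f := fun f hf => by
    rw [hr, dif_pos ⟨f, hf⟩]; exact (min_le_right _ _).trans (Finset.inf'_le _ hf)
  set R : ℝ := r⁻¹ ^ e + ∑ f ∈ Fp, |(rf f)⁻¹ ^ ef f| + ∑ f ∈ F, |Rg f| with hR
  have hR1 : r⁻¹ ^ e ≤ R := by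
    rw [hR]
    have h1 : 0 ≤ ∑ f ∈ Fp, |(rf f)⁻¹ ^ ef f| := Finset.sum_nonneg fun _ _ => abs_nonneg _
    have h2 : 0 ≤ ∑ f ∈ F, |Rg f| := Finset.sum_nonneg fun _ _ => abs_nonneg _
    linarith
  have hR2 : ∀ f ∈ Fp, (rf f)⁻¹ ^ ef f ≤ R := fun f hf => by
    rw [hR]
    have h0 : 0 ≤ r⁻¹ ^ e := by positivity
    have h1 : |(rf f)⁻¹ ^ ef f| ≤ ∑ f ∈ Fp, |(rf f)⁻¹ ^ ef f| :=
      Finset.single_le_sum (f := fun f => |(rf f)⁻¹ ^ ef f|) (fun _ _ => abs_nonneg _) hf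
    have h2 : 0 ≤ ∑ f ∈ F, |Rg f| := Finset.sum_nonneg fun _ _ => abs_nonneg _
    linarith [le_abs_self ((rf f)⁻¹ ^ ef f)]
  have hR3 : ∀ f ∈ F, Rg f ≤ R := fun f hf => by
    rw [hR]
    have h0 : 0 ≤ r⁻¹ ^ e := by positivity
    have h1 : 0 ≤ ∑ f ∈ Fp, |(rf f)⁻¹ ^ ef f| := Finset.sum_nonneg fun _ _ => abs_nonneg _
    have h2 : |Rg f| ≤ ∑ f ∈ F, |Rg f| :=
      Finset.single_le_sum (f := fun f => |Rg f|) (fun _ _ => abs_nonneg _) hf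
    linarith [le_abs_self (Rg f)]
  -- the atlas
  set B : Finset ((ℂ → ℂ) × ℕ) := Fp.attach.biUnion fun f =>
    (Finset.univ : Finset (Fin f.1.natDegree)).biUnion fun i =>
      (nthRootsFinset (ef f.1) (1 : ℂ)).image fun ζ =>
        ((fun s : ℂ => yf f.1 i (ζ * s ^ (e / ef f.1)) * (ζ ^ Mf f.1)⁻¹), e / ef f.1 * Mf f.1)
    with hB
  have hn : ∀ f ∈ Fp, 0 < e / ef f ∧ (e / ef f) * ef f = e := fun f hf =>
    ⟨Nat.div_pos (Nat.le_of_dvd hepos (hdvd f hf)) (hef f (hFp f hf)),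
      Nat.div_mul_cancel (hdvd f hf)⟩
  refine ⟨e, hepos, R, r, hr0, hr1, B, ?_, ?_⟩
  · -- differentiability of the atlas functions
    intro b hb
    simp only [hB, Finset.mem_biUnion, Finset.mem_attach, true_and, Finset.mem_univ,
      Finset.mem_image, Subtype.exists] at hb
    obtain ⟨f, hf, i, ζ, hζ, rfl⟩ := hb
    dsimp only
    have hζ1 : ‖ζ‖ = 1 := by
      have h1 : ζ ^ ef f = 1 := (mem_nthRootsFinset (hef f (hFp f hf)) 1).1 hζ
      have h2 : ‖ζ‖ ^ ef f = 1 := by rw [← norm_pow, h1, norm_one]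
      exact (pow_eq_one_iff_of_nonneg (norm_nonneg ζ) (hef f (hFp f hf)).ne').1 h2
    obtain ⟨hnpos, -⟩ := hn f hf
    have hmaps : MapsTo (fun s : ℂ => ζ * s ^ (e / ef f)) (ball 0 r) (ball 0 (rf f)) := by
      intro s hs
      rw [mem_ball_zero_iff] at hs ⊢
      rw [norm_mul, hζ1, one_mul, norm_pow]
      have hs1 : ‖s‖ ≤ 1 := hs.le.trans hr1
      calc ‖s‖ ^ (e / ef f) ≤ ‖s‖ := pow_le_of_le_one (norm_nonneg s) hs1 hnpos.ne'
        _ < r := hs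
        _ ≤ rf f := hrf' f hf
    exact ((hyf f (hFp f hf) i).comp (by fun_prop) hmaps).mul_const _
  · intro u v hu hPuv t ht
    have hupos : r⁻¹ ^ e < ‖u‖ := lt_of_le_of_lt hR1 hu
    have hu0 : u ≠ 0 := by
      rintro rfl; rw [norm_zero] at hupos
      exact absurd hupos (not_lt.2 (by positivity))
    have ht0 : t ≠ 0 := by
      rintro rfl; rw [zero_pow hepos.ne'] at ht; exact inv_ne_zero hu0 ht.symm
    have htr : ‖t‖ < r := by
      have h1 : ‖t‖ ^ e = ‖u‖⁻¹ := by rw [← norm_pow, ht, norm_inv]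
      have h2 : ‖u‖⁻¹ < r ^ e := by
        rw [inv_pow] at hupos
        exact inv_lt_of_inv_lt₀ (pow_pos hr0 e) hupos
      exact lt_of_pow_lt_pow_left₀ e hr0.le (h1 ▸ h2)
    refine ⟨ht0, htr, ?_⟩
    -- a vanishing irreducible factor, of positive degree
    have hQuv : (Q.map (evalRingHom u)).eval v = 0 := by rw [hQval]; exact hPuv
    obtain ⟨f, hfF, hfuv⟩ := exists_factor_eval_eq_zero hQ0 hQuv
    have hfF' : f ∈ F := Multiset.mem_toFinset.2 hfF
    have hfirr : Irreducible f := hirr f hfF'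
    have hfdeg : 0 < f.natDegree := by
      by_contra hd
      have hd0 : f.natDegree = 0 := Nat.eq_zero_of_not_pos hd
      exact hRg f ⟨hfirr.ne_zero, hd0⟩ u (lt_of_le_of_lt (hR3 f hfF') hu) v hfuv
    have hfFp : f ∈ Fp := by rw [hFpdef, Finset.mem_filter]; exact ⟨hfF', hfdeg⟩
    -- Puiseux for `f`
    obtain ⟨i, t', ht'0, -, ht'e, hv⟩ :=
      hrootf f (hFp f hfFp) u v (lt_of_le_of_lt (hR2 f hfFp) hu) hfuv
    obtain ⟨hnpos, hne⟩ := hn f hfFp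
    set n : ℕ := e / ef f with hndef
    -- the root of unity relating `t'` to `t ^ n`
    have htn0 : t ^ n ≠ 0 := pow_ne_zero n ht0
    set ζ : ℂ := t' * (t ^ n)⁻¹ with hζ
    have hζt : t' = ζ * t ^ n := by rw [hζ, mul_assoc, inv_mul_cancel₀ htn0, mul_one]
    have hζpow : ζ ^ ef f = 1 := by
      rw [hζ, mul_pow, ht'e, inv_pow, ← pow_mul, hne, ht, mul_inv_cancel₀ (inv_ne_zero hu0)]
    have hζ0 : ζ ≠ 0 := by
      rintro h0; rw [h0, zero_pow (hef f (hFp f hfFp)).ne'] at hζpow; exact zero_ne_one hζpow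
    have hζmem : ζ ∈ nthRootsFinset (ef f) (1 : ℂ) :=
      (mem_nthRootsFinset (hef f (hFp f hfFp)) 1).2 hζpow
    refine ⟨((fun s : ℂ => yf f i (ζ * s ^ n) * (ζ ^ Mf f)⁻¹), n * Mf f), ?_, ?_⟩
    · simp only [hB, Finset.mem_biUnion, Finset.mem_attach, true_and, Finset.mem_univ,
        Finset.mem_image, Subtype.exists]
      exact ⟨f, hfFp, i, ζ, hζmem, rfl⟩
    · dsimp only
      rw [hv, hζt, mul_pow, pow_mul]
      field_simp

end PuiseuxInfinity

end Literature.Analysis.Complex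

end
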